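import Summits.Langlands.Langlands.Theorems.IrreducibilityBySelfDualityHeckeEigenvalueFieldStubConeGrowthDeriv
import HarnessLib

/-!
# Crux `HeckeEigenvalueField` (stmt-Langlands-13632), line `Sketch`, stub GROWTH-ω:
# the cone form is smooth on the positive cone, with polynomial `C¹` growth

Namespace `Summit.Langlands.Langlands.Theorems.HeckeEigenvalueField.Res`; the registered stub
`stub_coneForm_growth` of `Lines/Sketch.lean` (parts 1–4: `…StubConeGrowthCoeff / Eval / LeftForm / Deriv`).

For the cone form `ω = ConeDictionary.coneForm π S λ η c` of a cochain `η` of the `(𝔤, K_∞)`-complex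
in degree `q + 1`:

* **smoothness on the cone** — locally `ω` is the pull-back of the (smooth) left-trivialised form along
  a smooth local section of the hermitian square (`coneForm_eventuallyEq_pullback`,
  `contDiffAt_leftForm`, `cfg_contDiffAt_altCompCLM`);
* **`‖ω(H)‖, ‖Dω(H)‖ ≤ C (1 + ∑ (‖H_ij‖ + ‖H⁻¹_ij‖))^k`** — the size
  `sz(g) = 1 + ∑ (‖g_ij‖ + ‖g⁻¹_ij‖)` of `g ∈ G_∞` controls `‖ω_left(g)‖`, `‖Dω_left(g)‖`
  polynomially (parts 1–3: algebraic coefficient representation, moderate growth of the automorphic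
  forms spanning the values of `η` and of `X · η(Y)`, height of `(g, c)`); at `H` with chosen square
  root `g = sec H` the pointwise bounds of part 4 apply with one dominating quantity
  `t ≤ K sz(g)^{k₀+k₁+1}`; and `sz(g) ≤ (2n² + 1)(1 + ∑ (‖H_ij‖ + ‖H⁻¹_ij‖))` since
  `‖g_ij‖² ≤ ‖H_ii‖`, `‖g⁻¹_ij‖² ≤ ‖H⁻¹_jj‖` for ANY square root.

[cite: BorelWallach2000, VII 2.2–2.5] [cite: BorelJacquetCorvallis1979, §1.2 and 4.2]
-/

set_option linter.dupNamespace false -- project-wide: `Summit.Langlands.Langlands` is the mandated namespace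

noncomputable section

open scoped Matrix.Norms.Operator ContDiff Topology TensorProduct Classical Matrix ComplexConjugate
open Filter NumberField NumberField.mixedEmbedding
open Literature.NumberTheory.Automorphic Literature.NumberTheory.Automorphic.RealMatrixGroup
  Literature.NumberTheory.Automorphic.ConeDictionary

-- Same instance context as the c8 file `…ResConeAnalytic` (whose lemmas are used throughout) and as the
-- registered signature: calculus of FORM-valued maps on `M_n(K_∞)` along ONE topology, the operator
-- norm `Matrix.Norms.Operator`; the product-topology instances are removed, and the derived normed
-- structures on `hermSpace n K →L[ℝ] _` are found along the `NormedAddCommGroup` instance of `hermSpace`.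
attribute [-instance] instTopologicalSpaceMatrix
attribute [-instance] Matrix.instUniformSpace
attribute [local instance high] NormedAddCommGroup.toSeminormedAddCommGroup

namespace Summit.Langlands.Langlands.Theorems.HeckeEigenvalueField.Res

section Final

variable {n : ℕ} {K : Type} [Field K] [NumberField K] {hcpt : isCompact_glFiniteIntegralLevel n K}
  (π : AutomorphicRepData (AutomorphyDatum.gl n K hcpt))
  (S : Finset {w : InfinitePlace K // w.IsReal}) (lam : (K →+* ℂ) → Fin n → ℤ) {q : ℕ}

set_option maxHeartbeats 800000 in
-- the chosen square roots are read in the archimedean group of the datum (abbrev towers)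
/-- **Stub GROWTH-ω — the cone form is smooth on the cone, with polynomial `C¹` growth in the entries
of `H` and `H⁻¹`** (the form re-typed by `id` over the operator-norm topology of `M_n(K_∞)`, as c8's
`leftFormN`; the same function).  Smoothness: c8 `coneForm_eventuallyEq_pullback` + `contDiffAt_leftForm`; the bounds:
`ω_c(g gᴴ)(v) = E(g) η(g⁻¹ v g⁻ᴴ …)(g, c)`, `E = σ_S` is an algebraic representation (matrix
coefficients polynomial in the entries of `g, g⁻¹`), the finitely many `K`-finite automorphic forms
spanning the values of `η` and of `X · η(Y)` (`fderiv_leftForm_apply`) have MODERATE GROWTH (uniformly in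
`g_∞` for the fixed finite component `c`), and for ANY square root `g` of `H`:
`∑ ‖g_ij‖² = tr H`, `∑ ‖(g⁻¹)_ij‖² = tr H⁻¹`. [cite: BorelJacquetCorvallis1979, §1.2]
[cite: BorelWallach2000, VII 2.2] -/
theorem stub_coneForm_growth {n : ℕ} {K : Type} [Field K] [NumberField K]
    {hcpt : isCompact_glFiniteIntegralLevel n K} (π : AutomorphicRepData (AutomorphyDatum.gl n K hcpt))
    (S : Finset {w : InfinitePlace K // w.IsReal}) (lam : (K →+* ℂ) → Fin n → ℤ) {q : ℕ}
    {η : ConeDictionary.Cochain π lam (q + 1)}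
    (hη : η ∈ (ConeDictionary.gkComplexLS π S lam).carrier (q + 1)) (c : BigHeckeGLn.FiniteAdelicGL n K) :
    ContDiffOn ℝ ((⊤ : ℕ∞) : WithTop ℕ∞) (fun H => @id (ResGLnCone.hermSpace n K [⋀^Fin (q + 1)]→L[ℝ] ResGLnCohomology.CoeffModule ℂ n K lam)
      (ConeDictionary.coneForm π S lam η c H)) (ResGLnCone.posCone n K) ∧
    ∃ (C : ℝ) (k : ℕ), ∀ H ∈ ResGLnCone.posCone n K,
      ‖@id (ResGLnCone.hermSpace n K [⋀^Fin (q + 1)]→L[ℝ] ResGLnCohomology.CoeffModule ℂ n K lam)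
          (ConeDictionary.coneForm π S lam η c H)‖ ≤ C * (1 + ∑ i, ∑ j,
          (‖(H : Matrix (Fin n) (Fin n) (mixedSpace K)) i j‖ +
            ‖(H : Matrix (Fin n) (Fin n) (mixedSpace K))⁻¹ i j‖)) ^ k ∧
      ‖fderiv ℝ (fun H => @id (ResGLnCone.hermSpace n K [⋀^Fin (q + 1)]→L[ℝ] ResGLnCohomology.CoeffModule ℂ n K lam)
          (ConeDictionary.coneForm π S lam η c H)) H‖ ≤ C * (1 + ∑ i, ∑ j,
          (‖(H : Matrix (Fin n) (Fin n) (mixedSpace K)) i j‖ +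
            ‖(H : Matrix (Fin n) (Fin n) (mixedSpace K))⁻¹ i j‖)) ^ k := by
  refine ⟨fun H₀ hH₀ => ?_, ?_⟩
  · -- smoothness: locally the pull-back of the (smooth) left-trivialised form along a smooth section
    obtain ⟨s, hsu, hs, heq⟩ := coneForm_eventuallyEq_pullback π S lam hη c hH₀
    obtain ⟨u, hu⟩ := hsu
    have hΦ : ContDiffAt ℝ ∞ (leftTrivFormN π S lam η c) (s H₀) := by
      have h1 : ContDiffAt ℝ ∞ (leftFormN π S lam η c) (s H₀) := contDiffAt_leftForm π S lam η c ⟨u, hu⟩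
      have h2 : ContDiffAt ℝ ∞ (fun m : Matrix (Fin n) (Fin n) (mixedSpace K) =>
          ContinuousLinearMap.mul ℝ (Matrix (Fin n) (Fin n) (mixedSpace K)) (Ring.inverse m)) (s H₀) := by
        rw [← hu]
        exact (ContinuousLinearMap.mul ℝ (Matrix (Fin n) (Fin n) (mixedSpace K))).contDiff.comp_contDiffAt _
          (contDiffAt_ringInverse ℝ u)
      exact cfg_contDiffAt_altCompCLM h1 h2
    have hcomp : ContDiffAt ℝ ∞ (fun H => leftTrivFormN π S lam η c (s H)) H₀ := hΦ.comp H₀ hs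
    have hinf : (∞ : WithTop ℕ∞) + 1 ≤ ∞ := by simp
    have hds : ContDiffAt ℝ ∞ (fderiv ℝ s) H₀ := hs.fderiv_right hinf
    exact ((cfg_contDiffAt_altCompCLM hcomp hds).congr_of_eventuallyEq heq.symm).contDiffWithinAt
  -- the bounds
  obtain ⟨Pr, TT, hPr, hTT⟩ := cfg_exists_proj_tangent n K
  -- the size of an element of `G_∞`: `1 + ∑ (‖g_ij‖ + ‖g⁻¹_ij‖)`
  let sz : (AutomorphyDatum.gl n K hcpt).arch.carrier → ℝ := fun g =>
    1 + ∑ i, ∑ j, (‖((g : GL (Fin n) (mixedSpace K)) : Matrix (Fin n) (Fin n) (mixedSpace K)) i j‖ +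
      ‖(((g⁻¹ : (AutomorphyDatum.gl n K hcpt).arch.carrier) : GL (Fin n) (mixedSpace K)) :
        Matrix (Fin n) (Fin n) (mixedSpace K)) i j‖)
  have hnn : ∀ (g : (AutomorphyDatum.gl n K hcpt).arch.carrier) i j,
      0 ≤ ‖((g : GL (Fin n) (mixedSpace K)) : Matrix (Fin n) (Fin n) (mixedSpace K)) i j‖ +
        ‖(((g⁻¹ : (AutomorphyDatum.gl n K hcpt).arch.carrier) : GL (Fin n) (mixedSpace K)) :
          Matrix (Fin n) (Fin n) (mixedSpace K)) i j‖ := fun g i j => add_nonneg (norm_nonneg _) (norm_nonneg _)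
  have hsz : ∀ g, 1 ≤ sz g := fun g =>
    le_add_of_nonneg_right (Finset.sum_nonneg fun i _ => Finset.sum_nonneg fun j _ => hnn g i j)
  have hE : ∀ (g : (AutomorphyDatum.gl n K hcpt).arch.carrier) i j,
      ‖((g : GL (Fin n) (mixedSpace K)) : Matrix (Fin n) (Fin n) (mixedSpace K)) i j‖ ≤ sz g := fun g i j =>
    (le_add_of_nonneg_right (norm_nonneg _)).trans (cfg_le_one_add_sum (hnn g) i j)
  have hI : ∀ (g : (AutomorphyDatum.gl n K hcpt).arch.carrier) i j,
      ‖(((g⁻¹ : (AutomorphyDatum.gl n K hcpt).arch.carrier) : GL (Fin n) (mixedSpace K)) :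
        Matrix (Fin n) (Fin n) (mixedSpace K)) i j‖ ≤ sz g := fun g i j =>
    (le_add_of_nonneg_left (norm_nonneg _)).trans (cfg_le_one_add_sum (hnn g) i j)
  obtain ⟨C₀, k₀, hC₀, h₀⟩ := cfg_norm_leftFormN_growth π S lam sz hsz hE hI η c
  obtain ⟨C₁, k₁, hC₁, h₁⟩ := cfg_norm_fderiv_leftFormN_growth π S lam sz hsz hE hI η c
  -- the constants
  have hn2 : (0 : ℝ) ≤ (n : ℝ) ^ 2 := by positivity
  have hι0 : 0 ≤ ‖hermIncl (n := n) (K := K)‖ := ContinuousLinearMap.opNorm_nonneg _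
  have hT0 : 0 ≤ ‖TT‖ := ContinuousLinearMap.opNorm_nonneg _
  have hK0 : 0 ≤ C₀ + C₁ + (n : ℝ) ^ 2 + 1 + ‖hermIncl (n := n) (K := K)‖ + ‖TT‖ := by linarith
  refine ⟨(2 * q + 3) * ((C₀ + C₁ + (n : ℝ) ^ 2 + 1 + ‖hermIncl (n := n) (K := K)‖ + ‖TT‖) *
      (2 * (n : ℝ) ^ 2 + 1) ^ (k₀ + k₁ + 1)) ^ (7 * q + 9), (k₀ + k₁ + 1) * (7 * q + 9), fun H hH => ?_⟩
  -- the chosen square root of `H`, read in `G_∞`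
  obtain ⟨hu, hgH⟩ := sec_spec (exists_isUnit_mul_conjTranspose_eq_of_mem_posCone hH)
  let gX : (AutomorphyDatum.gl n K hcpt).arch.carrier := GLn.archOfMatrix n K (sec n K H)
  have hcoe : ((gX : GL (Fin n) (mixedSpace K)) : Matrix (Fin n) (Fin n) (mixedSpace K)) = sec n K H :=
    GLn.coe_archOfMatrix hu
  have hcoeI : (((gX⁻¹ : (AutomorphyDatum.gl n K hcpt).arch.carrier) : GL (Fin n) (mixedSpace K)) :
      Matrix (Fin n) (Fin n) (mixedSpace K)) = (sec n K H)⁻¹ := by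
    rw [Subgroup.coe_inv, Matrix.coe_units_inv, hcoe]
  have hinv : Ring.inverse (sec n K H) = (sec n K H)⁻¹ := (Matrix.nonsing_inv_eq_ringInverse _).symm
  -- the size of `H`
  have hP1 : (1 : ℝ) ≤ 1 + ∑ i, ∑ j, (‖(H : Matrix (Fin n) (Fin n) (mixedSpace K)) i j‖ +
      ‖(H : Matrix (Fin n) (Fin n) (mixedSpace K))⁻¹ i j‖) :=
    le_add_of_nonneg_right (Finset.sum_nonneg fun i _ => Finset.sum_nonneg fun j _ =>
      add_nonneg (norm_nonneg _) (norm_nonneg _))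
  have hP0 : (0 : ℝ) ≤ 1 + ∑ i, ∑ j, (‖(H : Matrix (Fin n) (Fin n) (mixedSpace K)) i j‖ +
      ‖(H : Matrix (Fin n) (Fin n) (mixedSpace K))⁻¹ i j‖) := zero_le_one.trans hP1
  -- the size of `H` controls the size of its square root: `‖g_ij‖², ‖g⁻¹_ij‖² ≤` entries of `H`, `H⁻¹`
  have hHinv : ((sec n K H)⁻¹)ᴴ * (sec n K H)⁻¹ = (H : Matrix (Fin n) (Fin n) (mixedSpace K))⁻¹ := by
    rw [← hgH, Matrix.mul_inv_rev, Matrix.conjTranspose_nonsing_inv]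
  have hszP : sz gX ≤ (2 * (n : ℝ) ^ 2 + 1) * (1 + ∑ i, ∑ j, (‖(H : Matrix (Fin n) (Fin n) (mixedSpace K)) i j‖ +
      ‖(H : Matrix (Fin n) (Fin n) (mixedSpace K))⁻¹ i j‖)) := by
    have he : ∀ i j, ‖(sec n K H) i j‖ ≤ 1 + ∑ i, ∑ j, (‖(H : Matrix (Fin n) (Fin n) (mixedSpace K)) i j‖ +
        ‖(H : Matrix (Fin n) (Fin n) (mixedSpace K))⁻¹ i j‖) := fun i j =>
      cfg_le_of_sq_le (norm_nonneg _) hP1 ((cfg_norm_entry_sq_le_of_mul_conjTranspose _ _ hgH i j).trans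
        ((le_add_of_nonneg_right (norm_nonneg _)).trans
          (cfg_le_one_add_sum (f := fun i j => ‖(H : Matrix (Fin n) (Fin n) (mixedSpace K)) i j‖ +
            ‖(H : Matrix (Fin n) (Fin n) (mixedSpace K))⁻¹ i j‖)
            (fun i j => add_nonneg (norm_nonneg _) (norm_nonneg _)) i i)))
    have hi : ∀ i j, ‖(sec n K H)⁻¹ i j‖ ≤ 1 + ∑ i, ∑ j, (‖(H : Matrix (Fin n) (Fin n) (mixedSpace K)) i j‖ +
        ‖(H : Matrix (Fin n) (Fin n) (mixedSpace K))⁻¹ i j‖) := fun i j =>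
      cfg_le_of_sq_le (norm_nonneg _) hP1 ((cfg_norm_entry_sq_le_of_conjTranspose_mul _ _ hHinv i j).trans
        ((le_add_of_nonneg_left (norm_nonneg _)).trans
          (cfg_le_one_add_sum (f := fun i j => ‖(H : Matrix (Fin n) (Fin n) (mixedSpace K)) i j‖ +
            ‖(H : Matrix (Fin n) (Fin n) (mixedSpace K))⁻¹ i j‖)
            (fun i j => add_nonneg (norm_nonneg _) (norm_nonneg _)) j j)))
    show 1 + ∑ i, ∑ j, (‖((gX : GL (Fin n) (mixedSpace K)) : Matrix (Fin n) (Fin n) (mixedSpace K)) i j‖ +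
      ‖(((gX⁻¹ : (AutomorphyDatum.gl n K hcpt).arch.carrier) : GL (Fin n) (mixedSpace K)) :
        Matrix (Fin n) (Fin n) (mixedSpace K)) i j‖) ≤ _
    rw [hcoe, hcoeI]
    calc 1 + ∑ i, ∑ j, (‖(sec n K H) i j‖ + ‖(sec n K H)⁻¹ i j‖)
        ≤ 1 + ∑ _i : Fin n, ∑ _j : Fin n, 2 * (1 + ∑ i, ∑ j, (‖(H : Matrix (Fin n) (Fin n) (mixedSpace K)) i j‖ +
            ‖(H : Matrix (Fin n) (Fin n) (mixedSpace K))⁻¹ i j‖)) := by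
          gcongr with i _ j _
          linarith [he i j, hi i j]
      _ = 1 + 2 * (n : ℝ) ^ 2 * (1 + ∑ i, ∑ j, (‖(H : Matrix (Fin n) (Fin n) (mixedSpace K)) i j‖ +
            ‖(H : Matrix (Fin n) (Fin n) (mixedSpace K))⁻¹ i j‖)) := by
          simp only [Finset.sum_const, Finset.card_univ, Fintype.card_fin]
          ring
      _ ≤ _ := by nlinarith
  -- one quantity `t` dominating everything at `g = sec H`
  have hszg1 : 1 ≤ sz gX := hsz gX
  have hszg0 : 0 ≤ sz gX := zero_le_one.trans hszg1
  have hA : ‖leftFormN π S lam η c (sec n K H)‖ ≤ C₀ * sz gX ^ k₀ := by rw [← hcoe]; exact h₀ gX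
  have hB : ‖fderiv ℝ (leftFormN π S lam η c) (sec n K H)‖ ≤ C₁ * sz gX ^ k₁ := by rw [← hcoe]; exact h₁ gX
  have hsg : ‖sec n K H‖ ≤ (n : ℝ) ^ 2 * sz gX := by rw [← hcoe]; exact cfg_opNorm_le_of_entries _ (hE gX)
  have hsi : ‖Ring.inverse (sec n K H)‖ ≤ (n : ℝ) ^ 2 * sz gX := by
    rw [hinv, ← hcoeI]
    exact cfg_opNorm_le_of_entries _ (hI gX)
  have hsiH : ‖(Ring.inverse (sec n K H))ᴴ‖ ≤ (n : ℝ) ^ 2 * sz gX := by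
    rw [hinv, ← hcoeI]
    exact cfg_opNorm_conjTranspose_le_of_entries _ (hI gX)
  obtain ⟨t, ht⟩ : ∃ t : ℝ, t = C₀ * sz gX ^ k₀ + C₁ * sz gX ^ k₁ + ((n : ℝ) ^ 2 * sz gX + 1) +
      ‖hermIncl (n := n) (K := K)‖ + ‖TT‖ := ⟨_, rfl⟩
  have hA' : 0 ≤ C₀ * sz gX ^ k₀ := by positivity
  have hB' : 0 ≤ C₁ * sz gX ^ k₁ := by positivity
  have hs' : 0 ≤ (n : ℝ) ^ 2 * sz gX := by positivity
  have ht1 : 1 ≤ t := by rw [ht]; linarith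
  obtain ⟨b0, bd⟩ := stub_coneGrowth_pointwise π S lam hη c Pr hPr TT hTT hH rfl ht1
    (hA.trans (by rw [ht]; linarith)) (hB.trans (by rw [ht]; linarith)) (hsg.trans (by rw [ht]; linarith))
    (hsi.trans (by rw [ht]; linarith)) (hsiH.trans (by rw [ht]; linarith)) (by rw [ht]; linarith)
    (by rw [ht]; linarith)
  -- `t ≤ K · sz^{k₀+k₁+1} ≤ K (2n²+1)^{k₀+k₁+1} · P(H)^{k₀+k₁+1}`
  have hpow : ∀ {a b : ℕ}, a ≤ b → sz gX ^ a ≤ sz gX ^ b := fun hab => pow_le_pow_right₀ hszg1 hab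
  have htK : t ≤ (C₀ + C₁ + (n : ℝ) ^ 2 + 1 + ‖hermIncl (n := n) (K := K)‖ + ‖TT‖) * sz gX ^ (k₀ + k₁ + 1) := by
    have e0 : C₀ * sz gX ^ k₀ ≤ C₀ * sz gX ^ (k₀ + k₁ + 1) := mul_le_mul_of_nonneg_left (hpow (by omega)) hC₀
    have e1 : C₁ * sz gX ^ k₁ ≤ C₁ * sz gX ^ (k₀ + k₁ + 1) := mul_le_mul_of_nonneg_left (hpow (by omega)) hC₁
    have e2 : (n : ℝ) ^ 2 * sz gX ≤ (n : ℝ) ^ 2 * sz gX ^ (k₀ + k₁ + 1) :=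
      mul_le_mul_of_nonneg_left (le_self_pow₀ hszg1 (by omega)) hn2
    have e3 : (1 : ℝ) ≤ sz gX ^ (k₀ + k₁ + 1) := one_le_pow₀ hszg1
    have e4 : ‖hermIncl (n := n) (K := K)‖ ≤ ‖hermIncl (n := n) (K := K)‖ * sz gX ^ (k₀ + k₁ + 1) :=
      le_mul_of_one_le_right hι0 (one_le_pow₀ hszg1)
    have e5 : ‖TT‖ ≤ ‖TT‖ * sz gX ^ (k₀ + k₁ + 1) := le_mul_of_one_le_right hT0 (one_le_pow₀ hszg1)
    rw [ht]
    nlinarith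
  have htP : t ≤ ((C₀ + C₁ + (n : ℝ) ^ 2 + 1 + ‖hermIncl (n := n) (K := K)‖ + ‖TT‖) *
      (2 * (n : ℝ) ^ 2 + 1) ^ (k₀ + k₁ + 1)) *
      (1 + ∑ i, ∑ j, (‖(H : Matrix (Fin n) (Fin n) (mixedSpace K)) i j‖ +
        ‖(H : Matrix (Fin n) (Fin n) (mixedSpace K))⁻¹ i j‖)) ^ (k₀ + k₁ + 1) := by
    refine htK.trans ?_
    rw [mul_assoc, ← mul_pow]
    exact mul_le_mul_of_nonneg_left (pow_le_pow_left₀ hszg0 hszP _) hK0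
  have ht0 : 0 ≤ t := zero_le_one.trans ht1
  have htpow : t ^ (7 * q + 9) ≤ (((C₀ + C₁ + (n : ℝ) ^ 2 + 1 + ‖hermIncl (n := n) (K := K)‖ + ‖TT‖) *
      (2 * (n : ℝ) ^ 2 + 1) ^ (k₀ + k₁ + 1)) ^ (7 * q + 9)) *
      (1 + ∑ i, ∑ j, (‖(H : Matrix (Fin n) (Fin n) (mixedSpace K)) i j‖ +
        ‖(H : Matrix (Fin n) (Fin n) (mixedSpace K))⁻¹ i j‖)) ^ ((k₀ + k₁ + 1) * (7 * q + 9)) := by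
    rw [pow_mul, ← mul_pow]
    exact pow_le_pow_left₀ ht0 htP _
  have hq1 : (1 : ℝ) ≤ 2 * q + 3 := by
    have : (0 : ℝ) ≤ q := Nat.cast_nonneg _
    linarith
  have hq0 : (0 : ℝ) ≤ 2 * q + 3 := zero_le_one.trans hq1
  constructor
  · calc _ ≤ t ^ (3 * q + 4) := b0
      _ ≤ 1 * t ^ (7 * q + 9) := by rw [one_mul]; exact pow_le_pow_right₀ ht1 (by omega)
      _ ≤ (2 * q + 3) * t ^ (7 * q + 9) := mul_le_mul_of_nonneg_right hq1 (by positivity)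
      _ ≤ _ := by rw [mul_assoc]; exact mul_le_mul_of_nonneg_left htpow hq0
  · calc _ ≤ (2 * q + 3) * t ^ (7 * q + 9) := bd
      _ ≤ _ := by rw [mul_assoc]; exact mul_le_mul_of_nonneg_left htpow hq0

end Final

end Summit.Langlands.Langlands.Theorems.HeckeEigenvalueField.Res

end
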